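import Summits.BirchSwinnertonDyer.Rank1Residual.X11b.BDPRouteSelmerCardBoundDatum
import Summits.BirchSwinnertonDyer.Rank1Residual.X11b.TamagawaHeegnerExact
import Literature.NumberTheory.EllipticCurves.NeronIsogenyScalingHoldsProofs
import HarnessLib

/-!
# Class X11b, route "BDP + converse-theorem engine + Kolyvagin" (p2): the on-tree reading and the
# algebraic discharge at EVERY ODD PRIME — `p = 3` included (cell `b2b-bsdres`, sub-cell
# `multr1-p2`, gen 18)

HONEST FRAMING (verbatim, cell `b2b-bsdres`, run/shared/lean/b2b/bsd-rank1-residual/): the goal of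
the cell is to DELETE the COMBINATION-SHAPED residual classes for ALL analytic-rank `≤ 1` curves
over `ℚ` — "full BSD formula for every rank `≤ 1` curve in class `C`" assembled STRICTLY from
published theorems — so that the rank-`≤ 1` remainder becomes exactly the CONSTRUCTION-SHAPED
classes, which are TYPED (missing-input Props), NOT attempted; this is not "finishing BSD".
Research route `p2` for class X11b (`ClassX11b W p := r_an = 1 ∧ p ≠ 2 ∧ mult(p) ∧ irr(p)`);
no claim beyond the stated class and loci; nothing booked; X11b stays CONSTRUCTION-SHAPED.
THEOREMS ONLY (no definition, no named fact, no `sorry`); the named odd-prime predicate and the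
`P2.`-records stated with it are in the companion `BDPRouteOpenInputOdd.lean`.

## What this file does

Since gen 11(C) the route's typed input STEP L is read on the sibling's CONSTRUCTED objects
(`X_ac(E[p^∞])`, `embAt`, `padicLogOrd`), and since gen 17 the whole algebraic side (anticyclotomic
control `≤`, the base Selmer count (3.2.1)+(calcul)) is kernel theorems — but every class-level
statement carried `5 ≤ p`, inherited from two places only: (i) the typed predicates
`P2ControlUpperOnTreeAt` / `P2OpenInputOnTreeAt` have `5 ≤ p →` among their antecedents; (ii) the
Tamagawa bookkeeping at the Heegner field (`ord_p ∏_{w∣N⁺} c_w = ord_p ∏_w c_w(E/K) = 2·ord_p ∏_ℓ c_ℓ(E)`)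
was proved through the twist with `c ≤ 4 < p`. (ii) is now EXACT and prime-free
(`TamagawaHeegnerExact.lean`: `∏_w c_w(E/K) = (∏_ℓ c_ℓ(E))²`), and the datum-level theorems behind (i)
never used `5 ≤ p`. This file assembles the consequence:

* (§1 is `BDPRouteSelmerCardBoundDatum.lean`: the Selmer count and (CTL≤)ᵗ at a DATUM, any prime.)
* §2 `indexLowerBoundAt_of_heegner_of_openInput_prime` — STEP L at a classical Heegner datum from
  THE open input at ONE `(κ, γ, 𝔭)`, every prime (the `p ≥ 5` of
  `indexLowerBoundAt_of_heegner_of_onTreeUpperInputs` removed: Tamagawa by `TamagawaHeegnerExact`,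
  control by §1).
* §3 `missingLowerBoundAt_of_classX11b_of_surj_of_openInput_odd` (one pair, any odd `p`, `Surj`;
  THE open input stated INLINE — verbatim the body of `P2OpenInputOnTreeAt` minus the antecedent
  `5 ≤ p`; at `p = 3` not even an announcement exists for it) and
  **`bsdp_of_classX11b_odd_of_onTreeInputs`**: `∀ (E,p) ∈` X11b (EVERY odd `p`) `→ BSD(E,p)` ⇐ twelve
  published named facts (Gross–Zagier, Kolyvagin ×2, Skinner 2016 Thm. C [`p ≥ 3`, footnote 1],
  Wuthrich 2014 Prop. 21, GZK, modularity ×2, Hoffstein–Luo, Mazur 1978 Cor. 4.1, Poitou–Tate, local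
  Euler characteristic) + the odd open input + (T2′) the Euler-system half off the unconditional atom
  `(ram) ∧ p ∤ ∏c` + (T4″) the non-surjective corner localised to `p ∣ ord_p Δ_min ∧ ¬(ram)`
  (`ClassX11b.dvd_and_not_ram_of_not_surj`, any odd `p`). This is gen 8's
  `bsdp_of_classX11b_odd_of_typedInputs_local` with its predicate-level STEP L binder `hL` REPLACED
  by the open input on tree objects and NO control / Selmer / Néron input;
  `bsdp_of_classX11b_three_of_onTreeInputs` is the `p = 3` row (in-window X11b-shape rows at `p = 3`:
  628 ‖ 214, hyp ledger). The companion `BDPRouteOpenInputOdd.lean` names the inline binder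
  (`P2OpenInputOnTreeOddAt`) and restates both as `P2.bsdp_of_onTree_algebraic_odd` /
  `P2.bsdp_three_of_onTree`.

CONDITIONAL on the named facts and typed inputs; nothing booked; labels UNCHANGED (X11 ∧ r = 1 at
`p = 3` stays CONSTRUCTION-SHAPED: its open input has no source at all).

References: [Castella2018] Thm. 2.3, (3.2.1), (calcul) (arXiv:1704.06608 pp. 5–6), Thm. 3.2 (p. 9);
[Castella2018Erratum] (2.4); [JetchevSkinnerWan2017] Prop. 3.2.1, §7.4.1, §7.3.1 (eq:tamK);
[Skinner2016PacificMC] Thm. C and footnote 1; [Wuthrich2014] Prop. 21; [MilneADT2006] I 2.8, 4.10(b);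
[Kolyvagin1990] Thm. A; [Mazur1978] Cor. 4.1; [Miller2011LMS] Def. 1.1.
-/

noncomputable section

open scoped Classical

open WeierstrassCurve NumberField IsDedekindDomain Field
open Literature.NumberTheory.EllipticCurves Literature.NumberTheory.EllipticCurves.GreenbergSelmer
  Literature.NumberTheory.EllipticCurves.ModularForms
  Literature.NumberTheory.EllipticCurves.Rank1Residual
  Literature.NumberTheory.EllipticCurves.Rank1Residual.Typed
  Literature.NumberTheory.EllipticCurves.Wuthrich2014
  Literature.NumberTheory.EllipticCurves.BalakrishnanEtAl2019
  Literature.NumberTheory.QuadraticFields.Quadratic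
  Literature.NumberTheory.Automorphic
  Literature.NumberTheory.GaloisRepresentations Literature.NumberTheory.GaloisCohomology
  Summit.BirchSwinnertonDyer.Rank1Residual.X11b.AcSelmer
  Summit.BirchSwinnertonDyer.Rank1Residual.X11b.LocBridge

namespace Summit.BirchSwinnertonDyer.Rank1Residual.X11b

/-! ### §2. STEP L at a classical Heegner datum from the open input, every prime -/

section StepL

variable {W : WeierstrassCurve ℚ} [W.IsElliptic] [W.IsGloballyMinimal] {K : Type} [Field K]
  [NumberField K] {p : ℕ} [Fact p.Prime] {κ : ZpExtension K p} {𝔭 : HeightOneSpectrum (𝓞 K)}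
  {γ : Field.absoluteGaloisGroup K} [Fact (κ.IsTopGenerator γ)] {ι : K →+* ℚ_[p]}

/-- **STEP L at a classical Heegner field from the one-sided links, `Ш(E/K)` finite, ANY prime**:
`indexLowerBoundAt_of_onTreeUpperLinks_of_heegner` with its `5 ≤ p` removed — the Tamagawa steps are
the prime-free `padicValNat_tamagawaProductSplit_eq_of_heegner_prime` /
`padicValNat_tamagawaProduct_baseChange_of_heegner_prime` (exact (eq:tamK)). CONDITIONAL on the open link.
[cite: JetchevSkinnerWan2017, §7.4.1 (eq:shalowerK-1) and §7.3.1 (eq:tamK) (arXiv:1512.06894 pp. 28, 30)]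
[cite: Castella2018, (1.1) (p. 2), Thm. 2.3 (p. 5), Thm. 3.2 (p. 9)] -/
theorem indexLowerBoundAt_of_onTreeUpperLinks_of_heegner_prime (hK : IsImaginaryQuadratic K)
    {N : ℕ} (hN : W.conductorNorm ℤ = N) (hH : SatisfiesHeegnerHypothesis N K)
    {P : (W.baseChange K).toAffine.Point} [Finite (W.baseChange K).sha]
    (hIW : IMCLowerWaldspurgerOnTreeAt p κ 𝔭 γ ι P) (hCTL : ControlUpperOnTreeAt p κ 𝔭 γ ι P) :
    IndexLowerBoundAt W p K P := by
  haveI : Finite (AddCommGroup.primaryComponent (W.baseChange K).sha p) :=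
    Finite.of_injective _ Subtype.val_injective
  have h := two_mul_index_le_of_onTreeUpperLinks hIW hCTL
  rw [padicValNat_tamagawaProductSplit_eq_of_heegner_prime W K p hN hH,
    padicValNat_tamagawaProduct_baseChange_of_heegner_prime W K p hK hN hH,
    padicValNat_card_addPrimaryComponent] at h
  unfold IndexLowerBoundAt
  rw [WeierstrassCurve.shaOrder]
  omega

end StepL

section HeegnerDatum

variable (W : WeierstrassCurve ℚ) [W.IsElliptic] [W.IsGloballyMinimal] (p : ℕ) [Fact p.Prime]
  (N : ℕ) [NeZero N] (K : Type) [Field K] [NumberField K]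
  (Dt : ModularParametrizationData W N) (H : HeegnerDatum N (NumberField.discr K)) (ι : K →+* ℂ)
  (P : (W.baseChange K).toAffine.Point)

/-- **STEP L at a classical Heegner datum from THE open input alone, ANY prime `p`** — multiplicative
`p` with `E[p]` irreducible, `ord_{s=1} L(E,s) = 1`, `K` imaginary quadratic Heegner for `N = N_E` with
`L(E^{d_K},1) ≠ 0`, `P` the Heegner point of `(Dt, H, ι)`: if (IMC≥∘BDP)ᵗ holds for every
anticyclotomic `κ`, generator `γ` and degree-one `𝔭 ∋ p` (with `embAt`), then
`IndexLowerBoundAt W p K P`. Finiteness of `Ш(E/K)` (Kolyvagin at the non-torsion Heegner point),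
existence of `(κ, γ, 𝔭)` (global reciprocity; `p ∣ N_E` splits in `K`), the control input (§1) and
the Tamagawa steps are theorems; published binders Gross–Zagier, Kolyvagin, modularity, Poitou–Tate,
local Euler characteristic. Gen 12's `indexLowerBoundAt_of_heegner_of_onTreeUpperInputs` without
`5 ≤ p` and without the control hypothesis. CONDITIONAL on the open link.
[cite: JetchevSkinnerWan2017, §7.4.1 (eq:shalowerK-1) (arXiv:1512.06894 p. 30)]
[cite: Castella2018, Thm. 2.3 (p. 5), Thm. 3.2 (p. 9)] [cite: Castella2018Erratum, (2.4) (p. 1)] [cite: Kolyvagin1990, Thm. A] -/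
theorem indexLowerBoundAt_of_heegner_of_openInput_prime
    (hGZ : gross_zagier N W K)
    (hKo : ∀ (N : ℕ) [NeZero N] (W : WeierstrassCurve ℚ) (K : Type) [Field K] [NumberField K],
      kolyvagin N W K)
    (hmod : hasEntireLFunction_rat)
    (hPT : ∀ (K : Type) [Field K] [NumberField K], poitouTate_sum_localTatePairing_eq_zero K)
    (hEP : ∀ (K : Type) [Field K] [NumberField K] (v : HeightOneSpectrum (𝓞 K)),
      localEulerPoincareCharacteristic (v.adicCompletion K))
    (hr : W.analyticRank = 1) (hmult : Mult W p) (hirr : Irr W p) (hN : W.conductorNorm ℤ = N)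
    (hK : IsImaginaryQuadratic K) (hHN : SatisfiesHeegnerHypothesis N K)
    (hLt : (W.quadraticTwist (NumberField.discr K : ℚ)).entireLFunction 1 ≠ 0)
    (hP : WeierstrassCurve.Affine.Point.map ι.toRatAlgHom P = heegnerPointComplex Dt H)
    (hA : ∀ (κ : ZpExtension K p), κ.IsAnticyclotomic →
      ∀ (γ : Field.absoluteGaloisGroup K) [Fact (κ.IsTopGenerator γ)] (𝔭 : HeightOneSpectrum (𝓞 K))
        (h𝔭 : ((p : ℕ) : 𝓞 K) ∈ 𝔭.asIdeal) (he : 𝔭.asIdeal.ramificationIdx (𝓞 ℚ) = 1)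
        (hf : 𝔭.asIdeal.inertiaDeg (𝓞 ℚ) = 1),
        IMCLowerWaldspurgerOnTreeAt p κ 𝔭 γ (embAt K p 𝔭 h𝔭 he hf) P) :
    IndexLowerBoundAt W p K P := by
  have hpN : p ∣ N := hN ▸ dvd_conductorNorm_of_mult hmult
  have hsplit : SplitsIn K p := hHN p Fact.out hpN
  have hPinf : ¬ IsOfFinAddOrder P :=
    not_isOfFinAddOrder_of_heegner_of_analyticRank_eq_one W N K Dt H ι P hGZ hmod hr hK hHN hLt hP
  haveI : Finite (W.baseChange K).sha :=
    finite_sha_baseChange_of_heegner W N K Dt H ι P hGZ (hKo N W K) hmod hr hK hHN hLt hP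
  obtain ⟨κ, γ, 𝔭, hκ, hγ, h𝔭⟩ := exists_anticyclotomic_generator_prime (p := p) hK
  haveI : Fact (κ.IsTopGenerator γ) := ⟨hγ⟩
  obtain ⟨he, hf⟩ := degreeOne_of_splitsIn hK.1 hsplit h𝔭
  exact indexLowerBoundAt_of_onTreeUpperLinks_of_heegner_prime hK hN hHN (hA κ hκ γ 𝔭 h𝔭 he hf)
    (controlUpperOnTreeAt_datum_of_facts hKo hPT hEP Dt H ι hmult hirr hN hK hHN hP hPinf hκ γ 𝔭 h𝔭
      he hf)

end HeegnerDatum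

/-! ### §3. Class level at every odd prime (the open input stated inline) -/

section Odd

variable (W : WeierstrassCurve ℚ) [W.IsElliptic] [W.IsGloballyMinimal] (p : ℕ) [Fact p.Prime]

/-- **The main-conjecture half `ord_p #Ш(E)_an ≤ ord_p #Ш(E)` at ONE X11b pair, ANY ODD `p`
(`p = 3` included), `ρ̄_{E,p}` onto, from THE open input at that pair** (stated inline: the body of
`P2OpenInputOnTreeAt` without its antecedent `5 ≤ p`). As `P2.missingLowerBoundAt_of_openInputAt`
(gen 18 end state) with the odd chain of §2: Hoffstein–Luo
supplies an odd-`d_K` Manin-good Heegner datum (`exists_oddHeegnerData`, `p ≠ 2`), §2 gives STEP L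
there, and `missingLowerBoundAt_of_indexLowerBoundAt_of_surj_odd` (Wuthrich Prop. 21 for the twist,
Gross–Zagier bookkeeping, `p ≠ 2`) concludes. Published binders: Gross–Zagier, Kolyvagin, Wuthrich
2014 Prop. 21, GZK, modularity ×2, Hoffstein–Luo, Mazur 1978 Cor. 4.1, Poitou–Tate, local Euler
characteristic; Néron scaling is the theorem `integral_neronScaling_of_isGloballyMinimal_holds`.
CONDITIONAL on the open input; nothing booked. [cite: Wuthrich2014, Prop. 21 (p. 400)]
[cite: JetchevSkinnerWan2017, §7.4.1 (pp. 30–31)] [cite: Castella2018, Thm. 2.3 (p. 5), Thm. 3.2 (p. 9)]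
[cite: Mazur1978, Cor. 4.1] [cite: Miller2011LMS, Def. 1.1] -/
theorem missingLowerBoundAt_of_classX11b_of_surj_of_openInput_odd
    (hGZ : ∀ (N : ℕ) [NeZero N] (W : WeierstrassCurve ℚ) (K : Type) [Field K] [NumberField K],
      gross_zagier N W K)
    (hKo : ∀ (N : ℕ) [NeZero N] (W : WeierstrassCurve ℚ) (K : Type) [Field K] [NumberField K],
      kolyvagin N W K)
    (hWu : sha_dvd_analyticSha)
    (hGZK : rank_eq_analyticRank_of_analyticRank_le_one) (hmod : hasEntireLFunction_rat)
    (hnf : exists_isNewformOf) (hHL : HoffsteinLuo1997_exists_twist_L_one_ne_zero)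
    (hMaz : mazur_not_dvd_maninConstant_of_odd)
    (hPT : ∀ (K : Type) [Field K] [NumberField K], poitouTate_sum_localTatePairing_eq_zero K)
    (hEP : ∀ (K : Type) [Field K] [NumberField K] (v : HeightOneSpectrum (𝓞 K)),
      localEulerPoincareCharacteristic (v.adicCompletion K))
    -- THE open input at this pair, any odd `p` (verbatim `P2OpenInputOnTreeAt` minus `5 ≤ p`)
    (hA : ∀ (N : ℕ) [NeZero N] (K : Type) [Field K] [NumberField K]
      (Dt : ModularParametrizationData W N) (H : HeegnerDatum N (NumberField.discr K)) (ι : K →+* ℂ)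
      (P : (W.baseChange K).toAffine.Point),
      ClassX11b W p → Surj W p → W.conductorNorm ℤ = N → IsImaginaryQuadratic K →
      Odd (NumberField.discr K) → ¬ (p : ℤ) ∣ NumberField.discr K → ¬ p ∣ Units.torsionOrder K →
      SatisfiesHeegnerHypothesis N K →
      (W.quadraticTwist (NumberField.discr K : ℚ)).entireLFunction 1 ≠ 0 →
      WeierstrassCurve.Affine.Point.map ι.toRatAlgHom P = heegnerPointComplex Dt H →
      ¬ (p : ℤ) ∣ Dt.c → ¬ IsOfFinAddOrder P →
      ∀ (κ : ZpExtension K p), κ.IsAnticyclotomic →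
        ∀ (γ : Field.absoluteGaloisGroup K) [Fact (κ.IsTopGenerator γ)]
          (𝔭 : HeightOneSpectrum (𝓞 K)) (h𝔭 : ((p : ℕ) : 𝓞 K) ∈ 𝔭.asIdeal)
          (he : 𝔭.asIdeal.ramificationIdx (𝓞 ℚ) = 1) (hf : 𝔭.asIdeal.inertiaDeg (𝓞 ℚ) = 1),
          IMCLowerWaldspurgerOnTreeAt p κ 𝔭 γ (embAt K p 𝔭 h𝔭 he hf) P)
    (hX : ClassX11b W p) (hsurj : Surj W p) :
    Typed.MissingLowerBoundAt W p := by
  have hNS : integral_neronScaling_of_isGloballyMinimal :=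
    integral_neronScaling_of_isGloballyMinimal_holds
  have hX' := hX
  obtain ⟨hr, hp2, hmult, hirr⟩ := hX
  haveI : NeZero (W.conductorNorm ℤ) := ⟨(W.conductorNorm_pos_holds).ne'⟩
  obtain ⟨K, _, _, Dt, H, ι, P, Wd, _, _, Cd, hK, hodd, hpd, hHN, hP, hc, hμ, hLt, hWd⟩ :=
    exists_oddHeegnerData hnf hHL hMaz hNS W p hr hp2 hmult hirr
  have hPinf : ¬ IsOfFinAddOrder P :=
    not_isOfFinAddOrder_of_heegner_of_analyticRank_eq_one W _ K Dt H ι P (hGZ _ W K) hmod hr hK hHN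
      hLt hP
  exact missingLowerBoundAt_of_indexLowerBoundAt_of_surj_odd W p K Dt H ι P (hGZ _ W K) (hKo _ W K)
    hWu hGZK hmod hr hp2 hmult hsurj hK hodd hpd hHN hP hc hμ hLt Wd Cd hWd
    (indexLowerBoundAt_of_heegner_of_openInput_prime W p _ K Dt H ι P (hGZ _ W K) hKo hmod hPT hEP
      hr hmult hirr rfl hK hHN hLt hP
      (hA _ K Dt H ι P hX' hsurj rfl hK hodd hpd hμ hHN hLt hP hc hPinf))

/-- **Route p2 at EVERY ODD PRIME — the on-tree record with the algebraic side discharged, `p = 3`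
included.** `∀ (E, p) ∈` X11b (`p` odd) `→ BSD(E, p)` from: TWELVE published named facts
(Gross–Zagier, Kolyvagin ×2, Skinner 2016 Thm. C [printed for `p ≥ 3`, footnote 1], Wuthrich 2014
Prop. 21, GZK, modularity ×2, Hoffstein–Luo, Mazur 1978 Cor. 4.1, Poitou–Tate (Milne I 4.10(b)),
local Euler characteristic (Milne I 2.8)) and the typed inputs
* (T1ᵗ-IMC, odd) THE open input, stated INLINE (verbatim `P2OpenInputOnTreeAt` minus `5 ≤ p`), at
  the surjective pairs [for `p ≥ 5`: erratum (2.4) ⇐ FW21 4.41, UNREFEREED; at `p = 3`: no source at all];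
* (T2′) the Euler-system half `Typed.MissingUpperBoundAt` on the surjective pairs OFF the
  unconditional atom `(ram) ∧ p ∤ ∏_ℓ c_ℓ` (where it is the theorem
  `missingUpperBoundAt_of_classX11b_of_ram_of_not_dvd`, any odd `p`);
* (T4″) `Typed.MissingPPartAt` on the non-surjective corner, localised to `p ∣ ord_p Δ_min ∧ ¬(ram)`
  (`ClassX11b.dvd_and_not_ram_of_not_surj`, any odd `p`; at `p ≥ 5` further to `p ∈ {5,7}` by
  Bilu–Parent–Rebolledo/BDMTV, `P2.bsdp_of_onTree_endState`).
NO control input, NO Selmer-count input, NO Néron binder, NO `5 ≤ p`: gen 8's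
`bsdp_of_classX11b_odd_of_typedInputs_local` with its STEP L binder replaced by the open input on
tree objects (named form: `P2.bsdp_of_onTree_algebraic_odd`, `BDPRouteOpenInputOdd.lean`).
CONDITIONAL; nothing booked; labels UNCHANGED.
[cite: JetchevSkinnerWan2017, §7.4.1–7.4.3 (pp. 30–31), Prop. 3.2.1] [cite: Castella2018, Thm. 2.3 (p. 5), (3.2.1), Thm. 3.2 (p. 9)]
[cite: Castella2018Erratum, (2.4) (p. 1)] [cite: Skinner2016PacificMC, Thm. C (§1) and footnote 1]
[cite: McCallumLMS1991, §1 Theorem (Kolyvagin), p. 296] [cite: Wuthrich2014, Prop. 21 (p. 400)]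
[cite: MilneADT2006, Ch. I, Thm. 4.10(b) and Thm. 2.8] [cite: SilvermanATAEC1994, V.6 Prop. 6.1 (p. 410)] [cite: Miller2011LMS, Def. 1.1] -/
theorem bsdp_of_classX11b_odd_of_onTreeInputs
    -- published inputs (named facts of the tree)
    (hGZ : ∀ (N : ℕ) [NeZero N] (W : WeierstrassCurve ℚ) (K : Type) [Field K] [NumberField K],
      gross_zagier N W K)
    (hKo : ∀ (N : ℕ) [NeZero N] (W : WeierstrassCurve ℚ) (K : Type) [Field K] [NumberField K],
      kolyvagin N W K)
    (hB : ∀ (N : ℕ) [NeZero N] (W : WeierstrassCurve ℚ) (K : Type) [Field K] [NumberField K],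
      Kolyvagin1990_padicValNat_card_sha_le N W K)
    (hSk : Skinner2016.thmC_padicValRat_bsd_rank_zero) (hWu : sha_dvd_analyticSha)
    (hGZK : rank_eq_analyticRank_of_analyticRank_le_one) (hmod : hasEntireLFunction_rat)
    (hnf : exists_isNewformOf) (hHL : HoffsteinLuo1997_exists_twist_L_one_ne_zero)
    (hMaz : mazur_not_dvd_maninConstant_of_odd)
    (hPT : ∀ (K : Type) [Field K] [NumberField K], poitouTate_sum_localTatePairing_eq_zero K)
    (hEP : ∀ (K : Type) [Field K] [NumberField K] (v : HeightOneSpectrum (𝓞 K)),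
      localEulerPoincareCharacteristic (v.adicCompletion K))
    -- (T1ᵗ-IMC, odd) THE open input (verbatim `P2OpenInputOnTreeAt` minus the antecedent `5 ≤ p`)
    (hA : ∀ (W : WeierstrassCurve ℚ) [W.IsElliptic] [W.IsGloballyMinimal] (p : ℕ) [Fact p.Prime]
      (N : ℕ) [NeZero N] (K : Type) [Field K] [NumberField K]
      (Dt : ModularParametrizationData W N) (H : HeegnerDatum N (NumberField.discr K)) (ι : K →+* ℂ)
      (P : (W.baseChange K).toAffine.Point),
      ClassX11b W p → Surj W p → W.conductorNorm ℤ = N → IsImaginaryQuadratic K →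
      Odd (NumberField.discr K) → ¬ (p : ℤ) ∣ NumberField.discr K → ¬ p ∣ Units.torsionOrder K →
      SatisfiesHeegnerHypothesis N K →
      (W.quadraticTwist (NumberField.discr K : ℚ)).entireLFunction 1 ≠ 0 →
      WeierstrassCurve.Affine.Point.map ι.toRatAlgHom P = heegnerPointComplex Dt H →
      ¬ (p : ℤ) ∣ Dt.c → ¬ IsOfFinAddOrder P →
      ∀ (κ : ZpExtension K p), κ.IsAnticyclotomic →
        ∀ (γ : Field.absoluteGaloisGroup K) [Fact (κ.IsTopGenerator γ)]
          (𝔭 : HeightOneSpectrum (𝓞 K)) (h𝔭 : ((p : ℕ) : 𝓞 K) ∈ 𝔭.asIdeal)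
          (he : 𝔭.asIdeal.ramificationIdx (𝓞 ℚ) = 1) (hf : 𝔭.asIdeal.inertiaDeg (𝓞 ℚ) = 1),
          IMCLowerWaldspurgerOnTreeAt p κ 𝔭 γ (embAt K p 𝔭 h𝔭 he hf) P)
    -- (T2′) the Euler-system half off the unconditional atom (ram) ∧ `p ∤ ∏ c_ℓ`
    (hU : ∀ (W : WeierstrassCurve ℚ) [W.IsElliptic] [W.IsGloballyMinimal] (p : ℕ) [Fact p.Prime],
      ClassX11b W p → Surj W p → ¬ (Ram W p ∧ ¬ p ∣ W.tamagawaProduct) →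
        Typed.MissingUpperBoundAt W p)
    -- (T4″) the non-surjective corner, localised: `p ∣ ord_p Δ_min`, no (ram) prime
    (hC : ∀ (W : WeierstrassCurve ℚ) [W.IsElliptic] [W.IsGloballyMinimal] (p : ℕ) [Fact p.Prime],
      ClassX11b W p → ¬ Surj W p → p ∣ padicValInt p W.minimalDiscriminantInt → ¬ Ram W p →
        Typed.MissingPPartAt W p)
    (W : WeierstrassCurve ℚ) [W.IsElliptic] [W.IsGloballyMinimal] (p : ℕ) [Fact p.Prime]
    (hX : ClassX11b W p) : BSDp W p := by
  refine Typed.bsdp_of_missingPPartAt W p hGZK (by rw [hX.1]) ?_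
  by_cases hs : Surj W p
  · refine Typed.missingPPartAt_of_lower_of_upper W p
      (missingLowerBoundAt_of_classX11b_of_surj_of_openInput_odd W p hGZ hKo hWu hGZK hmod hnf hHL
        hMaz hPT hEP (hA W p) hX hs) ?_
    by_cases hloc : Ram W p ∧ ¬ p ∣ W.tamagawaProduct
    · exact missingUpperBoundAt_of_classX11b_of_ram_of_not_dvd hGZ hKo hB hSk hGZK hmod hnf hHL hMaz
        integral_neronScaling_of_isGloballyMinimal_holds W p hX hloc.1 hloc.2
    · exact hU W p hX hs hloc
  · obtain ⟨hdvd, hnr⟩ := ClassX11b.dvd_and_not_ram_of_not_surj W p hX hs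
    exact hC W p hX hs hdvd hnr

/-- **The `p = 3` row of X11b (X11 ∧ `r = 1` at `p = 3`; in-window X11b-shape rows 628 ‖ 214): the
on-tree record at `p = 3`.** `∀ E` with `(E, 3) ∈` X11b `→ BSD(E, 3)` ⇐ the twelve published facts
+ THE open input at `p = 3` [stated inline; NO source, not even announced] + (T2′)@3 + (T4″)@3 —
the algebraic side (control `≤`, Selmer count, Tamagawa bookkeeping, Néron scaling) being kernel
theorems at `p = 3` exactly as at `p ≥ 5`. The `p = 3` case of `bsdp_of_classX11b_odd_of_onTreeInputs`,
with the typed inputs demanded at `p = 3` only (named form: `P2.bsdp_three_of_onTree`,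
`BDPRouteOpenInputOdd.lean`). CONDITIONAL; nothing booked; X11 ∧ `r = 1` at `p = 3` stays
CONSTRUCTION-SHAPED. [cite: Castella2018, Thm. 2.3 (p. 5), Thm. 3.2 (p. 9)]
[cite: Skinner2016PacificMC, Thm. C (§1) and footnote 1] [cite: Wuthrich2014, Prop. 21 (p. 400)] [cite: Miller2011LMS, Def. 1.1] -/
theorem bsdp_of_classX11b_three_of_onTreeInputs [Fact (Nat.Prime 3)]
    (hGZ : ∀ (N : ℕ) [NeZero N] (W : WeierstrassCurve ℚ) (K : Type) [Field K] [NumberField K],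
      gross_zagier N W K)
    (hKo : ∀ (N : ℕ) [NeZero N] (W : WeierstrassCurve ℚ) (K : Type) [Field K] [NumberField K],
      kolyvagin N W K)
    (hB : ∀ (N : ℕ) [NeZero N] (W : WeierstrassCurve ℚ) (K : Type) [Field K] [NumberField K],
      Kolyvagin1990_padicValNat_card_sha_le N W K)
    (hSk : Skinner2016.thmC_padicValRat_bsd_rank_zero) (hWu : sha_dvd_analyticSha)
    (hGZK : rank_eq_analyticRank_of_analyticRank_le_one) (hmod : hasEntireLFunction_rat)
    (hnf : exists_isNewformOf) (hHL : HoffsteinLuo1997_exists_twist_L_one_ne_zero)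
    (hMaz : mazur_not_dvd_maninConstant_of_odd)
    (hPT : ∀ (K : Type) [Field K] [NumberField K], poitouTate_sum_localTatePairing_eq_zero K)
    (hEP : ∀ (K : Type) [Field K] [NumberField K] (v : HeightOneSpectrum (𝓞 K)),
      localEulerPoincareCharacteristic (v.adicCompletion K))
    -- THE open input at `p = 3` (no source), stated inline
    (hA : ∀ (W : WeierstrassCurve ℚ) [W.IsElliptic] [W.IsGloballyMinimal]
      (N : ℕ) [NeZero N] (K : Type) [Field K] [NumberField K]
      (Dt : ModularParametrizationData W N) (H : HeegnerDatum N (NumberField.discr K)) (ι : K →+* ℂ)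
      (P : (W.baseChange K).toAffine.Point),
      ClassX11b W 3 → Surj W 3 → W.conductorNorm ℤ = N → IsImaginaryQuadratic K →
      Odd (NumberField.discr K) → ¬ (3 : ℤ) ∣ NumberField.discr K → ¬ 3 ∣ Units.torsionOrder K →
      SatisfiesHeegnerHypothesis N K →
      (W.quadraticTwist (NumberField.discr K : ℚ)).entireLFunction 1 ≠ 0 →
      WeierstrassCurve.Affine.Point.map ι.toRatAlgHom P = heegnerPointComplex Dt H →
      ¬ (3 : ℤ) ∣ Dt.c → ¬ IsOfFinAddOrder P →
      ∀ (κ : ZpExtension K 3), κ.IsAnticyclotomic →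
        ∀ (γ : Field.absoluteGaloisGroup K) [Fact (κ.IsTopGenerator γ)]
          (𝔭 : HeightOneSpectrum (𝓞 K)) (h𝔭 : ((3 : ℕ) : 𝓞 K) ∈ 𝔭.asIdeal)
          (he : 𝔭.asIdeal.ramificationIdx (𝓞 ℚ) = 1) (hf : 𝔭.asIdeal.inertiaDeg (𝓞 ℚ) = 1),
          IMCLowerWaldspurgerOnTreeAt 3 κ 𝔭 γ (embAt K 3 𝔭 h𝔭 he hf) P)
    -- (T2′)@3
    (hU : ∀ (W : WeierstrassCurve ℚ) [W.IsElliptic] [W.IsGloballyMinimal],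
      ClassX11b W 3 → Surj W 3 → ¬ (Ram W 3 ∧ ¬ 3 ∣ W.tamagawaProduct) →
        Typed.MissingUpperBoundAt W 3)
    -- (T4″)@3
    (hC : ∀ (W : WeierstrassCurve ℚ) [W.IsElliptic] [W.IsGloballyMinimal],
      ClassX11b W 3 → ¬ Surj W 3 → 3 ∣ padicValInt 3 W.minimalDiscriminantInt → ¬ Ram W 3 →
        Typed.MissingPPartAt W 3)
    (W : WeierstrassCurve ℚ) [W.IsElliptic] [W.IsGloballyMinimal] (hX : ClassX11b W 3) :
    BSDp W 3 := by
  refine Typed.bsdp_of_missingPPartAt W 3 hGZK (by rw [hX.1]) ?_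
  by_cases hs : Surj W 3
  · refine Typed.missingPPartAt_of_lower_of_upper W 3
      (missingLowerBoundAt_of_classX11b_of_surj_of_openInput_odd W 3 hGZ hKo hWu hGZK hmod hnf hHL
        hMaz hPT hEP (hA W) hX hs) ?_
    by_cases hloc : Ram W 3 ∧ ¬ 3 ∣ W.tamagawaProduct
    · exact missingUpperBoundAt_of_classX11b_of_ram_of_not_dvd hGZ hKo hB hSk hGZK hmod hnf hHL hMaz
        integral_neronScaling_of_isGloballyMinimal_holds W 3 hX hloc.1 hloc.2
    · exact hU W hX hs hloc
  · obtain ⟨hdvd, hnr⟩ := ClassX11b.dvd_and_not_ram_of_not_surj W 3 hX hs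
    exact hC W hX hs hdvd hnr

end Odd

end Summit.BirchSwinnertonDyer.Rank1Residual.X11b

end
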